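import Summits.QuantumFields.YangMills.Theorems.FluctuationComparisonRegPrIntLS2BetaLadderHolonomy
import Summits.QuantumFields.YangMills.Theorems.FluctuationComparisonRegPrIntLS2BetaRelativeStokes
import HarnessLib

/-!
# S2β · Q11a — THE RELATIVE LADDER LEMMA: the RELATIVE holonomy of a ladder swept by a word `w` and a unit translation `e` for TWO configurations `W, U` is within
# `|w|·ρ + 2·Σ_{bottom rail} dist1(U(b)⁻¹W(b))` of `1` when every RELATIVE plaquette along the rail is within `ρ` of `1` (any torus `Site P j`, any `GaugeGroup G`; NO smallness)

Cell `ym3-torus` (rung R3 = continuum `SU(2)` YM₃ on T³ at fixed lattice data — NOT d = 4, NOT infinite volume, NOT a mass gap, NOT Clay).  Width seat `ym3-torus-px5` (gen 23);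
crux `stmt-QuantumFields-20520`, LINE g18-1 S2β; GAP♯∘ ⟸ ✓p828867 {h3, D-GUARD×2, LOC}; LOC ⟸ (ST) (px17 g22's knit over Q7 ✓p827759 ∕ Q9b ✓p828684 ∕ Q10 ✓p828851); (ST) ⟸ (SCT) +
the LIFT RECURSION «chord = LIFT part + LADDER part» (UV3-NODE §94.5 (D), px17 g22).  THIS FILE is that recursion's summand AT THE GROUP LEVEL and radius-free: (B4a) ✓p825467
`dist1_ladder_le` (ONE configuration, absolute plaquettes) made RELATIVE (TWO configurations, relative plaquettes, rail chords).  `--kind proof --supports stmt-QuantumFields-20520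
--as helper`, count-neutral, DEFINITION-FREE (0 `def`, 0 `instance`, 0 `notation`, 0 `sorry`, default heartbeats); generic `P : Params`, ANY `GaugeGroup G`.

NOTATION (written out).  For a configuration `X`, a base site `z`, a word `w` and a direction `e`: the LADDER LOOP `loop_X := X(walk z w)·X⟨walkEnd z w, e⟩·X(walk (z+e) w)⁻¹·X⟨z, e⟩⁻¹`
((B4a)'s loop: bottom rail `walk z w`, far rung, top rail backwards, near rung); the RELATIVE PLAQUETTE of `q` is `(U∂q)⁻¹·(W∂q)` (the argument of the letter's `REL`); the bottom-rail CHORD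
of a step `s` is `U(s.bond)⁻¹·W(s.bond)`.

WHAT IS PROVED (sorry-free).
* §1 group bookkeeping from the four `dist1` axioms (`dist1_inv`, `dist1_conj`, `dist1_mul_le`, `dist1_one`): `dist1_mul_inv_eq_rel` (`dist1 (a·b⁻¹) = dist1 (b⁻¹·a)`),
  `dist1_mul_mid_le` (`dist1 (A·Z·B⁻¹) ≤ dist1 (A·B⁻¹) + dist1 Z`), `dist1_conj_rel_le` (`dist1 (c·X·c⁻¹·Q·Y⁻¹) ≤ 2·dist1 c + dist1 Q + dist1 (X·Y⁻¹)`).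
* §2 `dist1_square_rel_le` — the relative unit square at `z` spanned by `κ` (first) and `ν`: `dist1 (□_W·□_U⁻¹) ≤ ρ` when the relative plaquette at source `z` is (a plaquette,
  the inverse of one, or `1`).
* §3 ★★★`dist1_ladder_rel_le` — **`dist1 (loop_W·loop_U⁻¹) ≤ |w|·ρ + 2·Σ_{s ∈ walk z w} dist1 (U(s.bond)⁻¹·W(s.bond))`** whenever every plaquette whose source is a site of the bottom
  rail (`walkEnd z (w.take i)`, `i ≤ |w|`) has relative size `≤ ρ` (induction on `w` as in (B4a): peeling the first step conjugates the shorter relative ladder by the first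
  bottom-rail bond of `U`, at the cost of twice its chord, and multiplies by one relative unit square).  At the TOP stage of `AxStage` the rail chords VANISH (px17 ✓p828327
  `stageChord_treeComb_top`) and the bound is `|w|·ρ`; at lower stages they are the LIFTED chords (✓`stageChord_treeComb_eq_liftChord`).

HONEST SCOPE.  Group algebra on the tree's torus walks; nothing of Bałaban's analysis is asserted or proved ([Balaban1989LargeFieldII] p.382 / [Balaban1985Averaging] (9) p.19 are the
printed «tree-gauge bond = loop spanned by plaquettes» statements); (ST)∕(SCT)∕LOC, AVG₂♭-ax_q, «MULT♭-ax»∕«CRIT-ax», (D-stage), h3, GAP♯∘ (`stub_uniformFibreGapOrbit`, registry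
3732b7df UNTOUCHED, 0∕5), S2β, the five registered stubs, 20520, 19936, 19200, `YM3TorusSU2` NOT proved; no summit statement is proved by a helper; rung R3 — NOT d = 4, NOT infinite
volume, NOT a mass gap, NOT Clay; the Yang–Mills mass gap is NOT proved.
-/

set_option autoImplicit false

namespace Summit.QuantumFields.YangMills.Theorems.FluctuationComparisonRegPrIntLS2BetaRelativeLadderHolonomy

open Literature.MathematicalPhysics.QuantumFieldTheory.Balaban1983to89
open Literature.MathematicalPhysics.QuantumFieldTheory.Balaban1983to89.T4Continuum
open Literature.MathematicalPhysics.QuantumFieldTheory.Balaban1983to89.BlockAveraging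
open Summit.QuantumFields.YangMills.Theorems.FluctuationComparisonRegPrIntLS2BetaLadderHolonomy (unshift_shift_comm)
open Summit.QuantumFields.YangMills.Theorems.FluctuationComparisonRegPrIntLS2BetaRelativeStokes (dist1_mul_inv_eq_rel)

variable {P : Params} {j : ℕ} {G : Type*} [GaugeGroup G]

/-! ## §1 Group bookkeeping from the `dist1` axioms -/

section Group

/-- `dist1 (A·Z·B⁻¹) ≤ dist1 (A·B⁻¹) + dist1 Z` (`A·Z·B⁻¹ = (A·B⁻¹)·(B·Z·B⁻¹)`). [folklore] -/
theorem dist1_mul_mid_le (A Z B : G) : dist1 (A * Z * B⁻¹) ≤ dist1 (A * B⁻¹) + dist1 Z := by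
  have h : A * Z * B⁻¹ = (A * B⁻¹) * (B * Z * B⁻¹) := by group
  rw [h]
  refine (GaugeGroup.dist1_mul_le _ _).trans ?_
  rw [GaugeGroup.dist1_conj]

/-- `dist1 (c·X·c⁻¹·Q·Y⁻¹) ≤ 2·dist1 c + dist1 Q + dist1 (X·Y⁻¹)` — the one-rung step of the relative ladder. [folklore] -/
theorem dist1_conj_rel_le (c X Q Y : G) : dist1 (c * X * c⁻¹ * Q * Y⁻¹) ≤ 2 * dist1 c + dist1 Q + dist1 (X * Y⁻¹) := by
  have h1 : dist1 (c * X * c⁻¹ * Q * Y⁻¹) ≤ dist1 (c * X * c⁻¹ * Y⁻¹) + dist1 Q := dist1_mul_mid_le (c * X * c⁻¹) Q Y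
  have h2 : c * X * c⁻¹ * Y⁻¹ = c * (X * c⁻¹ * X⁻¹) * (X * Y⁻¹) := by group
  have h3 : dist1 (c * X * c⁻¹ * Y⁻¹) ≤ dist1 c + dist1 c⁻¹ + dist1 (X * Y⁻¹) := by
    rw [h2]
    have ha := GaugeGroup.dist1_mul_le (c * (X * c⁻¹ * X⁻¹)) (X * Y⁻¹)
    have hb := GaugeGroup.dist1_mul_le c (X * c⁻¹ * X⁻¹)
    have hconj : dist1 (X * c⁻¹ * X⁻¹) = dist1 c⁻¹ := GaugeGroup.dist1_conj c⁻¹ X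
    linarith
  rw [GaugeGroup.dist1_inv] at h3
  linarith

end Group

/-! ## §2 The relative unit square -/

section Square

/-- **THE RELATIVE UNIT SQUARE**: at a site `z` where every plaquette has relative size `≤ ρ` (`0 ≤ ρ`), the unit squares of `W` and `U` spanned by `e_κ` (first) and `e_ν` satisfy
`dist1 (□_W·□_U⁻¹) ≤ ρ` (a relative plaquette, the inverse of one, or `1` when `κ = ν`). [cite: Balaban1985Averaging, (9) p.19 (bookkeeping)] -/
theorem dist1_square_rel_le (W U : GaugeField P j G) {ρ : ℝ} (hρ0 : 0 ≤ ρ) (z : Site P j)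
    (hρ : ∀ q : Plaq P j, q.src = z → dist1 ((GaugeField.plaqHol U q)⁻¹ * GaugeField.plaqHol W q) ≤ ρ) (κ ν : Fin P.d) :
    dist1 ((W ⟨z, κ⟩ * W ⟨z.shift κ, ν⟩ * (W ⟨z.shift ν, κ⟩)⁻¹ * (W ⟨z, ν⟩)⁻¹) *
        (U ⟨z, κ⟩ * U ⟨z.shift κ, ν⟩ * (U ⟨z.shift ν, κ⟩)⁻¹ * (U ⟨z, ν⟩)⁻¹)⁻¹) ≤ ρ := by
  rcases lt_trichotomy κ ν with h | h | h
  · -- a plaquette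
    have hq := hρ ⟨z, κ, ν, h⟩ rfl
    rw [dist1_mul_inv_eq_rel]
    exact hq
  · subst h
    rw [mul_inv_cancel_right, mul_inv_cancel, mul_inv_cancel_right, mul_inv_cancel, mul_inv_cancel, GaugeGroup.dist1_one]
    exact hρ0
  · -- the inverse of a plaquette
    have hq := hρ ⟨z, ν, κ, h⟩ rfl
    have hW : W ⟨z, κ⟩ * W ⟨z.shift κ, ν⟩ * (W ⟨z.shift ν, κ⟩)⁻¹ * (W ⟨z, ν⟩)⁻¹ = (GaugeField.plaqHol W ⟨z, ν, κ, h⟩)⁻¹ := by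
      simp only [GaugeField.plaqHol, mul_inv_rev, inv_inv, mul_assoc]
    have hU : U ⟨z, κ⟩ * U ⟨z.shift κ, ν⟩ * (U ⟨z.shift ν, κ⟩)⁻¹ * (U ⟨z, ν⟩)⁻¹ = (GaugeField.plaqHol U ⟨z, ν, κ, h⟩)⁻¹ := by
      simp only [GaugeField.plaqHol, mul_inv_rev, inv_inv, mul_assoc]
    rw [hW, hU, inv_inv, ← GaugeGroup.dist1_inv, mul_inv_rev, inv_inv]
    exact hq

end Square

/-! ## §3 The relative ladder lemma -/

section Ladder

/-- ★★★ **THE RELATIVE LADDER LEMMA.**  For two configurations `W, U`, a word `w` walked from `z` and from `z + e`, closed by the rungs `⟨walkEnd z w, e⟩` and `⟨z, e⟩`: if every plaquette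
whose source is a site of the bottom rail has relative size `≤ ρ`, then
`dist1 (loop_W·loop_U⁻¹) ≤ |w|·ρ + 2·Σ_{s ∈ walk z w} dist1 (U(s.bond)⁻¹·W(s.bond))`
(induction on `w`: peeling the first step conjugates the shorter relative ladder by the first bottom-rail bond of `U` — at the cost of twice its chord — and multiplies by one relative unit
square).  The summand «chord = LIFT part + LADDER part» of the lift recursion at the group level: rails = comb bonds (chord `1` at the top stage, the lifted chord below), rungs free.
[cite: Balaban1989LargeFieldII, p.382 (Lemma 1 of [14]: a tree-gauge bond is a loop spanned by plaquettes); Balaban1985Averaging, (9) p.19] -/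
theorem dist1_ladder_rel_le (W U : GaugeField P j G) {ρ : ℝ} (hρ0 : 0 ≤ ρ) (S : Set (Site P j))
    (hρ : ∀ q : Plaq P j, q.src ∈ S → dist1 ((GaugeField.plaqHol U q)⁻¹ * GaugeField.plaqHol W q) ≤ ρ) (e : Fin P.d) :
    ∀ (w : List (Letter P.d)) (z : Site P j), (∀ i, i ≤ w.length → walkEnd z (w.take i) ∈ S) →
      dist1 ((holAt W (walk z w) * W ⟨walkEnd z w, e⟩ * (holAt W (walk (z.shift e) w))⁻¹ * (W ⟨z, e⟩)⁻¹) *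
          (holAt U (walk z w) * U ⟨walkEnd z w, e⟩ * (holAt U (walk (z.shift e) w))⁻¹ * (U ⟨z, e⟩)⁻¹)⁻¹) ≤
        w.length * ρ + 2 * ((walk z w).map (fun s : LStep P j => dist1 ((U s.bond)⁻¹ * W s.bond))).sum
  | [], z, _ => by
    simp only [walk, walkEnd, holAt_nil, one_mul, inv_one, mul_one, mul_inv_cancel, GaugeGroup.dist1_one, List.length_nil, Nat.cast_zero, zero_mul,
      List.map_nil, List.sum_nil, mul_zero, add_zero]
    exact le_rfl
  | (κ, true) :: w, z, hS => by
    have hS' : ∀ i, i ≤ w.length → walkEnd (z.shift κ) (w.take i) ∈ S := fun i hi => by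
      have h := hS (i + 1) (by simp only [List.length_cons]; omega)
      simpa only [List.take_succ_cons, walkEnd] using h
    have ih := dist1_ladder_rel_le W U hρ0 S hρ e w (z.shift κ) hS'
    have hz : z ∈ S := by simpa only [List.take_zero, walkEnd] using hS 0 (Nat.zero_le _)
    simp only [walk, walkEnd, holAt_cons, if_true, List.length_cons, Nat.cast_succ, List.map_cons, List.sum_cons]
    rw [BlockAveragingEMLProp2.shift_shift_comm z e κ]
    set AW := holAt W (walk (z.shift κ) w)
    set BW := holAt W (walk ((z.shift κ).shift e) w)
    set AU := holAt U (walk (z.shift κ) w)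
    set BU := holAt U (walk ((z.shift κ).shift e) w)
    set y := walkEnd (z.shift κ) w
    -- (B4a)'s decomposition, for each configuration
    have keyW : W ⟨z, κ⟩ * AW * W ⟨y, e⟩ * (W ⟨z.shift e, κ⟩ * BW)⁻¹ * (W ⟨z, e⟩)⁻¹ =
        (W ⟨z, κ⟩ * (AW * W ⟨y, e⟩ * BW⁻¹ * (W ⟨z.shift κ, e⟩)⁻¹) * (W ⟨z, κ⟩)⁻¹) *
          (W ⟨z, κ⟩ * W ⟨z.shift κ, e⟩ * (W ⟨z.shift e, κ⟩)⁻¹ * (W ⟨z, e⟩)⁻¹) := by group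
    have keyU : U ⟨z, κ⟩ * AU * U ⟨y, e⟩ * (U ⟨z.shift e, κ⟩ * BU)⁻¹ * (U ⟨z, e⟩)⁻¹ =
        (U ⟨z, κ⟩ * (AU * U ⟨y, e⟩ * BU⁻¹ * (U ⟨z.shift κ, e⟩)⁻¹) * (U ⟨z, κ⟩)⁻¹) *
          (U ⟨z, κ⟩ * U ⟨z.shift κ, e⟩ * (U ⟨z.shift e, κ⟩)⁻¹ * (U ⟨z, e⟩)⁻¹) := by group
    rw [keyW, keyU]
    set XW := AW * W ⟨y, e⟩ * BW⁻¹ * (W ⟨z.shift κ, e⟩)⁻¹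
    set XU := AU * U ⟨y, e⟩ * BU⁻¹ * (U ⟨z.shift κ, e⟩)⁻¹
    set QW := W ⟨z, κ⟩ * W ⟨z.shift κ, e⟩ * (W ⟨z.shift e, κ⟩)⁻¹ * (W ⟨z, e⟩)⁻¹
    set QU := U ⟨z, κ⟩ * U ⟨z.shift κ, e⟩ * (U ⟨z.shift e, κ⟩)⁻¹ * (U ⟨z, e⟩)⁻¹
    set r := U ⟨z, κ⟩
    set c := r⁻¹ * W ⟨z, κ⟩
    -- conjugate by `r` and regroup: the relative loop is `c·XW·c⁻¹·(r⁻¹·(QW·QU⁻¹)·r)·XU⁻¹` up to conjugation by `r⁻¹`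
    have hreg : W ⟨z, κ⟩ * XW * (W ⟨z, κ⟩)⁻¹ * QW * (r * XU * r⁻¹ * QU)⁻¹ =
        r * (c * XW * c⁻¹ * (r⁻¹ * (QW * QU⁻¹) * r) * XU⁻¹) * r⁻¹ := by
      simp only [c]; group
    rw [hreg, GaugeGroup.dist1_conj]
    refine (dist1_conj_rel_le c XW (r⁻¹ * (QW * QU⁻¹) * r) XU).trans ?_
    have hQ : dist1 (r⁻¹ * (QW * QU⁻¹) * r) ≤ ρ := by
      have h1 : r⁻¹ * (QW * QU⁻¹) * r = r⁻¹ * (QW * QU⁻¹) * r⁻¹⁻¹ := by rw [inv_inv]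
      rw [h1, GaugeGroup.dist1_conj]
      exact dist1_square_rel_le W U hρ0 z (fun q hq => hρ q (hq ▸ hz)) κ e
    have hc : dist1 c = dist1 ((U ⟨z, κ⟩)⁻¹ * W ⟨z, κ⟩) := rfl
    rw [hc] at *
    nlinarith [ih, hQ, GaugeGroup.dist1_nonneg ((U ⟨z, κ⟩)⁻¹ * W ⟨z, κ⟩)]
  | (κ, false) :: w, z, hS => by
    have hS' : ∀ i, i ≤ w.length → walkEnd (z.unshift κ) (w.take i) ∈ S := fun i hi => by
      have h := hS (i + 1) (by simp only [List.length_cons]; omega)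
      simpa only [List.take_succ_cons, walkEnd] using h
    have ih := dist1_ladder_rel_le W U hρ0 S hρ e w (z.unshift κ) hS'
    have hz' : z.unshift κ ∈ S := by simpa only [List.take, walkEnd] using hS 1 (by simp only [List.length_cons]; omega)
    simp only [walk, walkEnd, holAt_cons, List.length_cons, Nat.cast_succ, List.map_cons, List.sum_cons]
    rw [← unshift_shift_comm z κ e]
    set z' := z.unshift κ with hz'def
    set AW := holAt W (walk z' w)
    set BW := holAt W (walk (z'.shift e) w)
    set AU := holAt U (walk z' w)
    set BU := holAt U (walk (z'.shift e) w)
    set y := walkEnd z' w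
    have hz : z = z'.shift κ := (Site.shift_unshift z κ).symm
    have keyW : (W ⟨z', κ⟩)⁻¹ * AW * W ⟨y, e⟩ * ((W ⟨z'.shift e, κ⟩)⁻¹ * BW)⁻¹ * (W ⟨z, e⟩)⁻¹ =
        ((W ⟨z', κ⟩)⁻¹ * (AW * W ⟨y, e⟩ * BW⁻¹ * (W ⟨z', e⟩)⁻¹) * ((W ⟨z', κ⟩)⁻¹)⁻¹) *
          ((W ⟨z', κ⟩)⁻¹ * ((W ⟨z', κ⟩ * W ⟨z'.shift κ, e⟩ * (W ⟨z'.shift e, κ⟩)⁻¹ * (W ⟨z', e⟩)⁻¹)⁻¹) * ((W ⟨z', κ⟩)⁻¹)⁻¹) := by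
      rw [hz]; group
    have keyU : (U ⟨z', κ⟩)⁻¹ * AU * U ⟨y, e⟩ * ((U ⟨z'.shift e, κ⟩)⁻¹ * BU)⁻¹ * (U ⟨z, e⟩)⁻¹ =
        ((U ⟨z', κ⟩)⁻¹ * (AU * U ⟨y, e⟩ * BU⁻¹ * (U ⟨z', e⟩)⁻¹) * ((U ⟨z', κ⟩)⁻¹)⁻¹) *
          ((U ⟨z', κ⟩)⁻¹ * ((U ⟨z', κ⟩ * U ⟨z'.shift κ, e⟩ * (U ⟨z'.shift e, κ⟩)⁻¹ * (U ⟨z', e⟩)⁻¹)⁻¹) * ((U ⟨z', κ⟩)⁻¹)⁻¹) := by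
      rw [hz]; group
    simp only [Bool.false_eq_true, ↓reduceIte]
    rw [keyW, keyU]
    set XW := AW * W ⟨y, e⟩ * BW⁻¹ * (W ⟨z', e⟩)⁻¹
    set XU := AU * U ⟨y, e⟩ * BU⁻¹ * (U ⟨z', e⟩)⁻¹
    set QW := W ⟨z', κ⟩ * W ⟨z'.shift κ, e⟩ * (W ⟨z'.shift e, κ⟩)⁻¹ * (W ⟨z', e⟩)⁻¹
    set QU := U ⟨z', κ⟩ * U ⟨z'.shift κ, e⟩ * (U ⟨z'.shift e, κ⟩)⁻¹ * (U ⟨z', e⟩)⁻¹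
    set r := U ⟨z', κ⟩
    set c := r * (W ⟨z', κ⟩)⁻¹
    have hreg : (W ⟨z', κ⟩)⁻¹ * XW * (W ⟨z', κ⟩)⁻¹⁻¹ * ((W ⟨z', κ⟩)⁻¹ * QW⁻¹ * (W ⟨z', κ⟩)⁻¹⁻¹) *
          (r⁻¹ * XU * r⁻¹⁻¹ * (r⁻¹ * QU⁻¹ * r⁻¹⁻¹))⁻¹ =
        r⁻¹ * (c * (XW * QW⁻¹) * c⁻¹ * 1 * (XU * QU⁻¹)⁻¹) * r⁻¹⁻¹ := by
      simp only [c]; group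
    rw [hreg, GaugeGroup.dist1_conj]
    refine (dist1_conj_rel_le c (XW * QW⁻¹) 1 (XU * QU⁻¹)).trans ?_
    rw [GaugeGroup.dist1_one, add_zero]
    -- `dist1 ((XW·QW⁻¹)·(XU·QU⁻¹)⁻¹) ≤ dist1 (XW·XU⁻¹) + dist1 (QW⁻¹·QU)` and the latter is a relative square
    have hmid : dist1 (XW * QW⁻¹ * (XU * QU⁻¹)⁻¹) ≤ dist1 (XW * XU⁻¹) + dist1 (QW⁻¹ * QU) := by
      have h1 : XW * QW⁻¹ * (XU * QU⁻¹)⁻¹ = XW * (QW⁻¹ * QU) * XU⁻¹ := by group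
      rw [h1]
      exact dist1_mul_mid_le XW (QW⁻¹ * QU) XU
    have hQ : dist1 (QW⁻¹ * QU) ≤ ρ := by
      rw [← GaugeGroup.dist1_inv, mul_inv_rev, inv_inv]
      -- `dist1 (QU⁻¹·QW) = dist1 (QW·QU⁻¹)`
      rw [← dist1_mul_inv_eq_rel]
      exact dist1_square_rel_le W U hρ0 z' (fun q hq => hρ q (hq ▸ hz')) κ e
    have hc : dist1 c = dist1 ((U ⟨z', κ⟩)⁻¹ * W ⟨z', κ⟩) := by
      show dist1 (U ⟨z', κ⟩ * (W ⟨z', κ⟩)⁻¹) = _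
      rw [dist1_mul_inv_eq_rel, ← GaugeGroup.dist1_inv, mul_inv_rev, inv_inv]
    rw [hc] at *
    nlinarith [ih, hQ, hmid, GaugeGroup.dist1_nonneg ((U ⟨z', κ⟩)⁻¹ * W ⟨z', κ⟩)]

end Ladder

end Summit.QuantumFields.YangMills.Theorems.FluctuationComparisonRegPrIntLS2BetaRelativeLadderHolonomy
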